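import Summits.Ventures.HSemireg.WedgeHankelRecurrenceSchurCohnReal
import Mathlib.Analysis.Complex.Polynomial.GaussLucas
import Mathlib.Analysis.Complex.Convex

/-!
# Venture HSemireg — GAUSS–LUCAS COROLLARIES: **the derivative of a Hurwitz (resp. Schur) polynomial is Hurwitz (resp. Schur)**, hence `H_n(p) ≻ 0 ⇒ H_{n−1}(p′) ≻ 0` and
# `S_n(p) ≻ 0 ⇒ S_{n−1}(p′) ≻ 0` for the Hermite–Fujiwara (N183/N186) and Schur–Cohn (N193/N194) forms

HONEST FRAMING. Part of the Lean index of the computation cell `pub-hsemireg` (seat p10 gen 38, Sunday typer «UNIFORM-IN-n»).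
COMPLEX ∕ REAL POLYNOMIALS ONLY (Mathlib's Gauss–Lucas theorem `rootSet_derivative_subset_convexHull_rootSet` and the convexity of half-planes ∕ balls): no variety, no cohomology theory, no sheaf,
no Ext group and no semiregularity map is constructed here; nothing here says that HC / HC_CM / HC_AV holds; no Literature fact (unproved `Prop`) is declared or used.  Custodian versions as in
`WedgeHankelSiegelIdeal` (1/3).
SOURCE (cited; held text read): V. V. Prasolov, Polynomials §1.2.1 **Theorem 1.2.1 (Gauss–Lucas)** (`book:prasolovnd-polynomials` chunk p0018): «The roots of `P′` belong to the convex hull of the roots of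
the polynomial `P` itself.» — Mathlib `Polynomial.rootSet_derivative_subset_convexHull_rootSet` (USED, not restated).  THIS FILE (elementary corollaries, the printed locus being Gauss–Lucas):
the open left half-plane and the open unit disc are convex, so they contain the roots of `p′` when they contain those of `p`.
DEDUP DISCLOSURE (`rg` of the whole tree + Mathlib, 2026-09-02): Mathlib has Gauss–Lucas (2025) but no stability corollary; Literature ∕ Summits: none.  8 names: 0 hits tree-wide + Mathlib.

WHAT IS IN THE TREE.  N186 `posDef_hermiteFujiwara_iff`, N194 `posDef_schurCohn_iff`; Mathlib `rootSet_derivative_subset_convexHull_rootSet`, `convex_halfSpace_re_lt`, `convex_ball`, `convexHull_min`,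
`mem_rootSet`, `natDegree_derivative`, `derivative_map`.
THIS FILE (namespace `Summit.Ventures.HSemireg.Wedge.HankelOuter` continued; CHAINED on N195; 0 definitions):
* §904 `roots_derivative_subset_of_convex` (roots of `p` in a convex set ⇒ roots of `p′` in it), **`forall_re_neg_derivative`**, **`forall_norm_lt_one_derivative`**, real forms
  `forall_re_neg_derivative_real`, `forall_norm_lt_one_derivative_real`, matrix forms **`posDef_hermiteFujiwara_derivative`**, **`posDef_schurCohn_derivative`**, and the iterate
  `forall_re_neg_derivative_iterate`.
CAVEATS.  Elementary; nothing Ext-side.  New names only.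
-/

open Module Polynomial
open scoped Matrix Polynomial ComplexOrder

namespace Summit.Ventures.HSemireg.Wedge.HankelOuter

open Summit.Ventures.HSemireg.Wedge Summit.Ventures.HSemireg.Wedge.Hankel

/-! ## §904. Derivatives of stable polynomials -/

/-- **Gauss–Lucas, membership form: if all roots of `p ∈ ℂ[X]` lie in a convex set `K`, so do all roots of `p′`.** [Prasolov Thm 1.2.1 via Mathlib; this file §904] -/
theorem roots_derivative_subset_of_convex {p : ℂ[X]} {K : Set ℂ} (hK : Convex ℝ K) (h : ∀ z ∈ p.roots, z ∈ K) : ∀ z ∈ p.derivative.roots, z ∈ K := by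
  intro z hz
  have hd0 : p.derivative ≠ 0 := fun h0 => by rw [h0, roots_zero] at hz; exact Multiset.notMem_zero _ hz
  have hdeg : 0 < p.degree := by
    rcases lt_or_ge 0 p.degree with hlt | hle
    · exact hlt
    · exact absurd (derivative_of_natDegree_zero (natDegree_eq_zero_iff_degree_le_zero.2 hle)) hd0
  have hsub : p.rootSet ℂ ⊆ K := fun w hw => by
    rw [mem_rootSet] at hw
    exact h w ((mem_roots hw.1).2 hw.2)
  have hz' : z ∈ p.derivative.rootSet ℂ := by
    rw [mem_rootSet]
    exact ⟨hd0, (mem_roots hd0).1 hz⟩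
  exact convexHull_min hsub hK (rootSet_derivative_subset_convexHull_rootSet hdeg hz')

/-- **The derivative of a Hurwitz polynomial is Hurwitz** (the open left half-plane is convex). [Gauss–Lucas corollary; this file §904] -/
theorem forall_re_neg_derivative {p : ℂ[X]} (h : ∀ z ∈ p.roots, z.re < 0) : ∀ z ∈ p.derivative.roots, z.re < 0 :=
  roots_derivative_subset_of_convex (K := {c : ℂ | c.re < 0}) (convex_halfSpace_re_lt 0) h

/-- **The derivative of a Schur polynomial is Schur** (the open unit disc is convex). [Gauss–Lucas corollary; this file §904] -/
theorem forall_norm_lt_one_derivative {p : ℂ[X]} (h : ∀ z ∈ p.roots, ‖z‖ < 1) : ∀ z ∈ p.derivative.roots, ‖z‖ < 1 := by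
  have h' : ∀ z ∈ p.roots, z ∈ Metric.ball (0 : ℂ) 1 := fun z hz => by rw [Metric.mem_ball, dist_zero_right]; exact h z hz
  intro z hz
  have := roots_derivative_subset_of_convex (convex_ball (0 : ℂ) 1) h' z hz
  rwa [Metric.mem_ball, dist_zero_right] at this

/-- All higher derivatives of a Hurwitz polynomial are Hurwitz. [this file §904] -/
theorem forall_re_neg_derivative_iterate {p : ℂ[X]} (h : ∀ z ∈ p.roots, z.re < 0) (k : ℕ) : ∀ z ∈ (derivative^[k] p).roots, z.re < 0 := by
  induction k with
  | zero => simpa using h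
  | succ k ih => rw [Function.iterate_succ_apply']; exact forall_re_neg_derivative ih

/-- Real form: the derivative of a real Hurwitz polynomial is Hurwitz. [this file §904] -/
theorem forall_re_neg_derivative_real {p : ℝ[X]} (h : ∀ z ∈ (p.map (algebraMap ℝ ℂ)).roots, z.re < 0) : ∀ z ∈ (p.derivative.map (algebraMap ℝ ℂ)).roots, z.re < 0 := by
  rw [← derivative_map]
  exact forall_re_neg_derivative h

/-- Real form: the derivative of a real Schur polynomial is Schur. [this file §904] -/
theorem forall_norm_lt_one_derivative_real {p : ℝ[X]} (h : ∀ z ∈ (p.map (algebraMap ℝ ℂ)).roots, ‖z‖ < 1) : ∀ z ∈ (p.derivative.map (algebraMap ℝ ℂ)).roots, ‖z‖ < 1 := by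
  rw [← derivative_map]
  exact forall_norm_lt_one_derivative h

/-- **`H_n(p) ≻ 0 ⇒ H_{n−1}(p′) ≻ 0`** for `deg p = n`: positive definiteness of the Hermite–Fujiwara form descends to the derivative. [N186 + Gauss–Lucas; this file §904] -/
theorem posDef_hermiteFujiwara_derivative {n : ℕ} {p : ℂ[X]} (hp : p.natDegree = n) (h : (hermiteFujiwara n p).PosDef) : (hermiteFujiwara (n - 1) p.derivative).PosDef :=
  (posDef_hermiteFujiwara_iff (by rw [natDegree_derivative, hp])).2 (forall_re_neg_derivative ((posDef_hermiteFujiwara_iff hp).1 h))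

/-- **`S_n(p) ≻ 0 ⇒ S_{n−1}(p′) ≻ 0`** for `deg p = n`: positive definiteness of the Schur–Cohn form descends to the derivative. [N194 + Gauss–Lucas; this file §904] -/
theorem posDef_schurCohn_derivative {n : ℕ} {p : ℂ[X]} (hp : p.natDegree = n) (h : (schurCohn n p).PosDef) : (schurCohn (n - 1) p.derivative).PosDef :=
  (posDef_schurCohn_iff (by rw [natDegree_derivative, hp])).2 (forall_norm_lt_one_derivative ((posDef_schurCohn_iff hp).1 h))

end Summit.Ventures.HSemireg.Wedge.HankelOuter
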